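import Summits.KontsevichZagierPeriods.KontsevichZagierPeriods.Theorems.RootDecompZetaThreeFrontierThreeLayerP3

/-! # `RootDecompZetaThreeFrontierThreeLayerP4` — part 4/7 of the mechanical ≤340-line split of decomp-kz lens-1 g12 `ThreeLayer_v1.lean`
(sha256 4ebbf5d0…: §18 the diagonal-straightening move Σ / un-bending τ_v and their relations, §47 the layer ⟹ words algorithm;
`…GZLadder.stub_three_layer` of «gz_ladder» v4 on stmt-KontsevichZagierPeriods-32433 is proved in part 7).  Mathematics unchanged; part 4 continues part 3. -/

set_option linter.dupNamespace false

noncomputable section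

namespace Summit.KontsevichZagierPeriods.RootDecompZetaThreeFrontier.WordLayer

open Set MeasureTheory MvPolynomial
open Literature.NumberTheory.Transcendental
open Summit.KontsevichZagierPeriods.KontsevichZagierPeriods.Theses.RootDecompZetaThreeFrontier
open Summit.KontsevichZagierPeriods.KontsevichZagierPeriods.Theorems.RootDecompZetaThreeFrontierWordMoves (mem_simplex_three_iff)

section Straighten

open Literature.ModelTheory.ExponentialFields

/-- **The rotation move, constructor form**: `[r] ≡ [rotΦ_* r]`. -/
theorem rot_rel' (r : KZ.IntegralRep 3) (hr : r.domain = cellB₀) :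
    KZ.of r - KZ.of (rotRep r hr) ∈ KZ.relations :=
  rot_rel r (rotRep r hr) hr rfl fun p _ => by simp [rotRep, rotΨ_rotΦ]

/-! ## §47a  (gen 12) THE STRAIGHTENING CHAIN, GENERIC: `[g] ≡ [Δ₃, R∘swΦ] + [Δ₃, R∘rotΨ]`, `R = τ_v Σ g`,
and the un-bent integrands of the two diagonal normal forms `E_n = q t₂ⁿ/(t₁(t₀-t₂))`, `H = q/(t₁(1-t₂)(t₀-t₂))`. -/

/-- Auxiliary step `rotΨ_zero` (§47a): rotΨ zero. [bookkeeping] -/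
theorem rotΨ_zero (z : Fin 3 → ℝ) : rotΨ z 0 = z 1 := by simp [rotΨ]
/-- Auxiliary step `rotΨ_one` (§47a): rotΨ one. [bookkeeping] -/
theorem rotΨ_one (z : Fin 3 → ℝ) : rotΨ z 1 = z 2 := by simp [rotΨ]
/-- Auxiliary step `rotΨ_two` (§47a): rotΨ two. [bookkeeping] -/
theorem rotΨ_two (z : Fin 3 → ℝ) : rotΨ z 2 = z 0 := by simp [rotΨ]

/-- **the straightening chain** (Σ, τ_v, the `u = w` split, one swap, one rotation, disposal of the null plane), for EVERY
datum `g` on `Δ₃`: `[g] - [Δ₃, R ∘ swΦ] - [Δ₃, R ∘ rotΨ] ∈ KZ.relations` with `R = (τ_v)_* Σ_* g`. -/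
theorem straighten_chain (g : KZ.IntegralRep 3) (hg : g.domain = KZ.openOrderedSimplex 3) :
    ∃ rA rB : KZ.IntegralRep 3, rA.domain = KZ.openOrderedSimplex 3 ∧ rB.domain = KZ.openOrderedSimplex 3 ∧
      (∀ t, rA.integrand t = (bendRep (straightenRep g hg) rfl).integrand (swΦ t)) ∧
      (∀ t, rB.integrand t = (bendRep (straightenRep g hg) rfl).integrand (rotΨ t)) ∧
      KZ.of g - KZ.of rA - KZ.of rB ∈ KZ.relations := by
  set R := bendRep (straightenRep g hg) rfl with hR
  have h1 : KZ.of g - KZ.of R ∈ KZ.relations := straighten_bend_rel' g hg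
  have hsubA : cellA ⊆ R.domain := fun p hp => hp.1
  have hsubB : cellB ⊆ R.domain := fun p hp => hp.1
  set RA := restrictRep R cellA isSemialgebraic_cellA hsubA with hRA
  set RB := restrictRep R cellB isSemialgebraic_cellB hsubB with hRB
  have h2 : KZ.of R - KZ.of RA - KZ.of RB ∈ KZ.relations := cell_split_rel R rfl
  have h3 : KZ.of RA - KZ.of (swapRep RA rfl) ∈ KZ.relations := swap_rel' RA rfl
  have hsubB₀ : cellB₀ ⊆ RB.domain := fun p hp => (cellB_eq_union ▸ Or.inl hp : p ∈ cellB)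
  have hsubN : cellN ⊆ RB.domain := fun p hp => (cellB_eq_union ▸ Or.inr hp : p ∈ cellB)
  set RB₀ := restrictRep RB cellB₀ isSemialgebraic_cellB₀ hsubB₀ with hRB₀
  set RN := restrictRep RB cellN isSemialgebraic_cellN hsubN with hRN
  have h4 : KZ.of RB - KZ.of RB₀ - KZ.of RN ∈ KZ.relations :=
    split_rel RB cellB₀ cellN isSemialgebraic_cellB₀ isSemialgebraic_cellN disjoint_cellB₀_cellN cellB_eq_union
  have h5 : KZ.of RN ∈ KZ.relations := KZ.levelRel_le_relations (KZ.of_mem_levelRel_of_volume_eq_zero RN volume_cellN)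
  have h6 : KZ.of RB₀ - KZ.of (rotRep RB₀ rfl) ∈ KZ.relations := rot_rel' RB₀ rfl
  refine ⟨swapRep RA rfl, rotRep RB₀ rfl, rfl, rfl, fun t => rfl, fun t => rfl, ?_⟩
  have e : KZ.of g - KZ.of (swapRep RA rfl) - KZ.of (rotRep RB₀ rfl) =
      (KZ.of g - KZ.of R) + (KZ.of R - KZ.of RA - KZ.of RB) + (KZ.of RA - KZ.of (swapRep RA rfl)) +
        (KZ.of RB - KZ.of RB₀ - KZ.of RN) + (KZ.of RB₀ - KZ.of (rotRep RB₀ rfl)) + KZ.of RN := by abel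
  rw [e]
  exact KZ.relations.add_mem (KZ.relations.add_mem (KZ.relations.add_mem (KZ.relations.add_mem
    (KZ.relations.add_mem h1 h2) h3) h4) h6) h5

/-- the un-bent integrand of `E_n = [Δ₃, q t₂ⁿ/(t₁(t₀-t₂))]`: `q (w-v)ⁿ(1-w)/((1-v)ⁿ⁺² u w)` on `stCell` -/
theorem unbent_E (q : ℚ) (n : ℕ) (g : KZ.IntegralRep 3) (hg : g.domain = KZ.openOrderedSimplex 3)
    (hi : EqOn g.integrand (fun t => (q : ℝ) * t 2 ^ n / (t 1 * (t 0 - t 2))) g.domain)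
    {p : Fin 3 → ℝ} (hp : p ∈ stCell) :
    (bendRep (straightenRep g hg) rfl).integrand p =
      (q : ℝ) * (p 2 - p 1) ^ n * (1 - p 2) / ((1 - p 1) ^ (n + 2) * p 0 * p 2) := by
  have hq : bendInv p ∈ stDom := bendInv_mem hp
  have hmem : stΨ (bendInv p) ∈ g.domain := by rw [hg]; exact stΨ_mem_simplex hq
  obtain ⟨h10, h0, h1, h12, h2⟩ := hp
  have hv : (1 : ℝ) - p 1 ≠ 0 := by linarith
  have hu : p 0 ≠ 0 := by linarith
  have hw : p 2 ≠ 0 := by linarith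
  have h2' : (1 : ℝ) - p 2 ≠ 0 := by linarith
  have hb0 : bendInv p 0 = p 0 := by simp [bendInv]
  have hb1 : bendInv p 1 = p 1 := by simp [bendInv]
  have hb2 : bendInv p 2 = (p 2 - p 1) / (1 - p 1) := by simp [bendInv]
  have hX : 1 - bendInv p 2 = (1 - p 2) / (1 - p 1) := by
    rw [hb2, eq_div_iff hv]
    field_simp
    ring
  have ht02 : stΨ (bendInv p) 0 - stΨ (bendInv p) 2 = p 0 * ((1 - p 2) / (1 - p 1)) := by
    rw [stΨ_zero, stΨ_two, hb0, hX]; ring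
  have ht1 : stΨ (bendInv p) 1 = p 2 := by
    rw [stΨ_one, hb1, hX, hb2]
    field_simp
    ring
  rw [bendRep_integrand, straightenRep_integrand, hi hmem]
  beta_reduce
  rw [ht02, ht1, stΨ_two, hX, hb2]
  simp only [div_pow]
  field_simp
  ring

/-- the un-bent integrand of `H = [Δ₃, q/(t₁(1-t₂)(t₀-t₂))]`: `q/((1-v) u w)` on `stCell` -/
theorem unbent_H (q : ℚ) (g : KZ.IntegralRep 3) (hg : g.domain = KZ.openOrderedSimplex 3)
    (hi : EqOn g.integrand (fun t => (q : ℝ) / (t 1 * (1 - t 2) * (t 0 - t 2))) g.domain)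
    {p : Fin 3 → ℝ} (hp : p ∈ stCell) :
    (bendRep (straightenRep g hg) rfl).integrand p = (q : ℝ) / ((1 - p 1) * p 0 * p 2) := by
  have hq : bendInv p ∈ stDom := bendInv_mem hp
  have hmem : stΨ (bendInv p) ∈ g.domain := by rw [hg]; exact stΨ_mem_simplex hq
  obtain ⟨h10, h0, h1, h12, h2⟩ := hp
  have hv : (1 : ℝ) - p 1 ≠ 0 := by linarith
  have hu : p 0 ≠ 0 := by linarith
  have hw : p 2 ≠ 0 := by linarith
  have h2' : (1 : ℝ) - p 2 ≠ 0 := by linarith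
  have hb0 : bendInv p 0 = p 0 := by simp [bendInv]
  have hb1 : bendInv p 1 = p 1 := by simp [bendInv]
  have hb2 : bendInv p 2 = (p 2 - p 1) / (1 - p 1) := by simp [bendInv]
  have hX : 1 - bendInv p 2 = (1 - p 2) / (1 - p 1) := by
    rw [hb2, eq_div_iff hv]
    field_simp
    ring
  have ht02 : stΨ (bendInv p) 0 - stΨ (bendInv p) 2 = p 0 * ((1 - p 2) / (1 - p 1)) := by
    rw [stΨ_zero, stΨ_two, hb0, hX]; ring
  have ht1 : stΨ (bendInv p) 1 = p 2 := by
    rw [stΨ_one, hb1, hX, hb2]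
    field_simp
    ring
  rw [bendRep_integrand, straightenRep_integrand, hi hmem]
  beta_reduce
  rw [ht02, ht1, stΨ_two, hX]
  field_simp

end Straighten

end Summit.KontsevichZagierPeriods.RootDecompZetaThreeFrontier.WordLayer
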